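import Summits.QuantumAdvantage.QuantumAdvantage.Theses.HankelLift
import HarnessLib

/-!
# Route HankelLift, crux `BeyondRectangles` (stmt-QuantumAdvantage-18440): objects of the registered line `birth`

Definitions only.  The registered skeleton `Cruxes/BeyondRectangles/Lines/birth.lean` (skeleton sha
`f6a15a6c0aead5bb`, `ledger skeleton check` 2026-08-17T16:30Z, vet PASS) cuts the hypothesis-type crux
`HankelLift.BeyondRectangles` ("no PPT beats the best rectangle rule with `k ≤ n²` labels by `1/10` on
`λ(x+y+2)` over uniform `n`-bit pairs, infinitely often") into three stubs

  `stub_liouvilleBPPDark`       (hardness; hypothesis-type, the bet — lift-free),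
  `stub_antidiagonalSampling`   (complexity glue; TRUE: the sum-lift is transparent to PPT),
  `stub_successCalibration`     (probability glue; TRUE: success = `4ⁿ/2 − pairCorr/2`),

composed as `BeyondRectangles_of`.  This file re-homes the skeleton's OBJECTS, bodies VERBATIM (so that
the stub files of this crux state the registered stubs under their registered names and signatures over
these names — CONVENTIONS §1/§6: route-posited objects live in a `…Defs.lean` file, never in a proof
file), and names the one open, load-bearing proposition:

* `enc`, `liftLang`      — the pair encoding `⟨bitsₙ x, bitsₙ y⟩` and the lifted language `L⁺` of the crux;
* `successSum`, `agreeCount` — numerators of the two sides of the crux (PPT success / rule agreement);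
* `hankelSign`, `accept`, `pairCorr` — `λ(x+y+2) ∈ {±1}`, `t_A(x,y) = Pr[A = true]`, and the PAIR
  correlation `Σ_{(x,y)} λ(x+y+2)·(2 t_A − 1)`;
* `antidiag`, `encSum`, `sumCorr` — the antidiagonal multiplicity `rₙ(m) = #{(x,y) ∈ [2ⁿ]² : x+y = m}`
  (the triangular law of the sum), the `(n+1)`-bit code of a sum, and the SUM correlation of a
  single-integer predictor `B`, `Σ_{m<2ⁿ⁺¹} rₙ(m)·λ(m+2)·(2·Pr[B(m) = true] − 1)`;
* `LiouvilleBPPDark : Prop` — the body of `stub_liouvilleBPPDark` verbatim: for every PPT `B`,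
  `|sumCorr B n| ≤ 4ⁿ/6` for infinitely many `n` (average-case Liouville randomness against BPP
  observables under the triangular law; the randomized, i.o., constant-correlation variant of Pudlák's
  "λ is pseudorandom against P", arXiv:1210.4692 Def. 2 — OPEN, hypothesis-type, subject to
  `Literature.Barriers.QuantumAdvantage.SeparationPrerequisites` exactly as the crux is).

WHAT THIS IS NOT: nothing is claimed about `LiouvilleBPPDark` or the crux; no separation is moved.
-/

-- the sub-problem namespace `Summit.QuantumAdvantage.QuantumAdvantage` repeats the summit name by design (D-0017)
set_option linter.dupNamespace false

noncomputable section

namespace Summit.QuantumAdvantage.QuantumAdvantage.Theorems.BeyondRectangles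

-- Same scopes as the route file, so that the copied sub-terms of the crux elaborate to the very same terms
-- (in particular the same `Decidable` instances inside `Finset.filter`).
open scoped BigOperators Topology Manifold Classical MeasureTheory ProbabilityTheory Matrix InnerProductSpace ComplexConjugate ContinuousMap
open Filter Set Function TopologicalSpace MeasureTheory
open Literature.QuantumAdvantage
open Literature.Computability.Complexity (RandAlg)

/-! ### The objects of the crux, named (verbatim sub-terms of the route decl `BeyondRectangles`) -/

/-- The pair encoding of the crux: `enc n x y = boolPair (bitsₙ x) (bitsₙ y)` (little-endian `n`-bit blocks;
registered skeleton `Lines/birth.lean`, verbatim). [cite: AroraBarak2009, §0.1] -/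
def enc (n x y : ℕ) : List Bool :=
  Literature.Computability.Complexity.boolPair (List.ofFn fun i : Fin n => Nat.testBit x i)
    (List.ofFn fun i : Fin n => Nat.testBit y i)

/-- The lifted Liouville language `L⁺ = {enc n x y : x, y < 2ⁿ, λ(x + y + 2) = −1}` (the `L` of the crux;
registered skeleton, verbatim). [cite: Pudlak2013Pseudorandomness, §2.3] -/
def liftLang : Language Bool :=
  {w | ∃ n x y : ℕ, x < 2 ^ n ∧ y < 2 ^ n ∧ w = enc n x y ∧ ArithmeticFunction.liouville (x + y + 2) = -1}

/-- Total success of `A` at level `n`: `Σ_{(x,y) ∈ [2ⁿ]²} Pr[A(enc n x y) = [enc n x y ∈ L⁺]]` (verbatim the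
numerator of the crux's left-hand side; registered skeleton, verbatim). [cite: BogdanovTrevisan2006, Def. 2.13] -/
def successSum (A : RandAlg (List Bool) Bool) (n : ℕ) : ℝ :=
  ∑ p ∈ (Finset.univ : Finset (Fin (2 ^ n) × Fin (2 ^ n))),
    A.pr id (enc n p.1 p.2) {Set.boolIndicator liftLang (enc n p.1 p.2)}

/-- Agreement count of the product-partition ("rectangle") rule `(x, y) ↦ g (a x) (b y)` with the Hankel sign
pattern `[λ(x + y + 2) = −1]` on `[2ⁿ]²` (verbatim the numerator of the crux's right-hand side; registered
skeleton, verbatim). [cite: KushilevitzNisan1996, §1.2] -/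
def agreeCount (n k : ℕ) (a b : Fin (2 ^ n) → Fin k) (g : Fin k → Fin k → Bool) : ℕ :=
  (Finset.univ.filter fun p : Fin (2 ^ n) × Fin (2 ^ n) =>
    g (a p.1) (b p.2) = decide (ArithmeticFunction.liouville (p.1.val + p.2.val + 2) = -1)).card

/-- The Hankel sign pattern `λ(x + y + 2) ∈ {±1}` as a real number (registered skeleton, verbatim).
[cite: Green2012, §1] -/
def hankelSign (n : ℕ) (p : Fin (2 ^ n) × Fin (2 ^ n)) : ℝ :=
  ((ArithmeticFunction.liouville (p.1.val + p.2.val + 2) : ℤ) : ℝ)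

/-- Acceptance probability `t_A(x, y) = Pr_r[A(enc n x y; r) = true]` (registered skeleton, verbatim).
[cite: AroraBarak2009, §7.1] -/
def accept (A : RandAlg (List Bool) Bool) (n : ℕ) (p : Fin (2 ^ n) × Fin (2 ^ n)) : ℝ :=
  A.pr id (enc n p.1 p.2) {true}

/-- PAIR correlation of `A`'s mean output with the Hankel pattern at level `n`:
`pairCorr A n = Σ_{(x,y) ∈ [2ⁿ]²} λ(x + y + 2)·(2·t_A(x, y) − 1) ∈ [−4ⁿ, 4ⁿ]` (registered skeleton, verbatim).
[cite: BogdanovTrevisan2006, Def. 2.13] -/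
def pairCorr (A : RandAlg (List Bool) Bool) (n : ℕ) : ℝ :=
  ∑ p ∈ (Finset.univ : Finset (Fin (2 ^ n) × Fin (2 ^ n))), hankelSign n p * (2 * accept A n p - 1)

/-- Antidiagonal multiplicity `rₙ(m) = #{(x, y) ∈ [2ⁿ]² : x + y = m}` — the law of the sum of two independent
uniform `n`-bit integers (times `4ⁿ`): `min(m + 1, 2ⁿ⁺¹ − 1 − m)` on `[0, 2ⁿ⁺¹ − 2]`, else `0` (registered
skeleton, verbatim). [cite: AroraBarak2009, §18.2] -/
def antidiag (n m : ℕ) : ℕ :=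
  ((Finset.univ : Finset (Fin (2 ^ n) × Fin (2 ^ n))).filter fun p => p.1.val + p.2.val = m).card

/-- The `(n+1)`-bit little-endian encoding of a sum `m < 2ⁿ⁺¹` (the input of the single-integer predictor `B`;
its length tells `B` the level `n`; registered skeleton, verbatim). [cite: AroraBarak2009, §0.1] -/
def encSum (n m : ℕ) : List Bool :=
  List.ofFn fun i : Fin (n + 1) => Nat.testBit m i

/-- SUM correlation of a single-integer predictor `B` with the shifted Liouville function under the triangular
law: `sumCorr B n = Σ_{m < 2ⁿ⁺¹} rₙ(m)·λ(m + 2)·(2·Pr[B(encSum n m) = true] − 1) ∈ [−4ⁿ, 4ⁿ]` (registered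
skeleton, verbatim). [cite: BogdanovTrevisan2006, Def. 2.13] -/
def sumCorr (B : RandAlg (List Bool) Bool) (n : ℕ) : ℝ :=
  ∑ m ∈ Finset.range (2 ^ (n + 1)),
    (antidiag n m : ℝ) * ((ArithmeticFunction.liouville (m + 2) : ℤ) : ℝ) * (2 * B.pr id (encSum n m) {true} - 1)

/-! ### The one open, load-bearing proposition of the line -/

/-- **`LiouvilleBPPDark`** — the body of the registered stub `stub_liouvilleBPPDark` VERBATIM (hypothesis-type,
the bet of the line; refuters first, never a proving target): for every probabilistic polynomial-time `B`
reading one integer `m` as `n + 1` bits there are infinitely many `n` with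
`|Σ_{m<2ⁿ⁺¹} rₙ(m)·λ(m+2)·(2·Pr[B(m)=true] − 1)| ≤ 4ⁿ/6` (correlation `≤ 1/6` under the triangular law of
`x + y`).  Nearest print form: Pudlák, arXiv:1210.4692, Definition 2 + §2.3 ("pseudorandom" = uncorrelated
with every polynomial-time `f : ℕ → {±1}`; "μ is pseudorandom iff λ is"; its AC⁰ rung is Green's theorem
arXiv:1103.4991; "if μ is pseudorandom then integers cannot be factored in polynomial time") — this is its
randomized, triangular-weight, constant-correlation, infinitely-often variant (bib: Pudlak2013Pseudorandomness,
BogdanovTrevisan2006 Def. 2.13 for the correlation currency).  A ROUTE-POSITED OPEN HYPOTHESIS (not a published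
fact, hence deliberately no cite tag): with the route's proved items and `stub_antidiagonalSampling` it implies
the summit (`SeparationPrerequisites` pattern, conceded). -/
def LiouvilleBPPDark : Prop :=
  ∀ B : RandAlg (List Bool) Bool, B.IsPolyTime id Computability.encodeBool →
    ∃ᶠ n : ℕ in Filter.atTop, |sumCorr B n| ≤ (4 : ℝ) ^ n / 6

end Summit.QuantumAdvantage.QuantumAdvantage.Theorems.BeyondRectangles

end
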